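/-
Copyright: the b2b-balaban T⁴-continuum CRUX team, row NE7b leaf lineage `t4-ne7b-formalise-leaf-01` (gen 84). Project licence.
-/
import Mathlib.Algebra.Order.BigOperators.Ring.Finset
import Mathlib.Analysis.SpecialFunctions.Pow.Real
import Mathlib.Data.Matrix.Mul
import Mathlib.Tactic.Linarith
import Mathlib.Tactic.Positivity
import Mathlib.Tactic.Ring

/-!
# THE (R-M) `ℓ²` LETTER FROM AN AVERAGE DOMINATION: a remainder dominated by a block `L¹` average, `|(R A)(c)| ≤ ε·Σ_{b∈dbl(c)} w_b|A_b|`, with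
# block masses `≤ D` and multiplicities `≤ μ`, satisfies `Σ_c (R A)(c)² ≤ ε²·D·μ·Σ_b w_b A_b²` — the constant `c_E² := ε²Dμ` of the displayed
# (R-M) letter `Σ_c |(E_kA)(c)|² ≤ c_E²‖A‖²_{L²(Ω_k)}` from THREE COUNTED LETTERS, in the `hE` shape of `…AveragedCurlFormSplit`
# (row NE7b, node U5c; the (h1) slot of print's `γ₀` assembly, `HOME/b2b-balaban-r1/SectE-interface-proof.md` §5.3 «Jensen on `Q″_k` gives the
# `ℓ²`-form»; [folklore] Cauchy–Schwarz ∕ Jensen + an exchange of two finite sums)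

Cell `pub-balaban`, sub-cell `t4`, spine estimate NE7b (`T4WeightBudget.RelWeightBound`; the cell's OWN estimate — NOT PRINTED in
[Bałaban 1983–89], NOT PROVED).  Crux-route work under `Spine/NE7b/` by a row leaf (`t4-ne7b-formalise-leaf-01` gen 84) on the windowed
convexity road (R-P1) under FREEZE (0)'s crux-prover clause; NOTHING of Bałaban's is named as a Lean object, valued or asserted; no
`T4Continuum/Support` leaf typed; no `def`; zero `sorry`.  Imports: Mathlib only (`Finset.sum_sq_le_sum_mul_sum_of_sq_le_mul` — Cauchy–Schwarz for
finsets —, `Finset.sum_comm`, `Matrix.mulVec`) — independent of the hub's olean frontier; the consumer `…AveragedCurlFormSplit` (leaf-02 g132, staged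
today) is met BY SHAPE (its `hE` binder verbatim), not imported.

WHY.  The written repair of print's `γ₀` interface ([B9] CMP **99** Sect. E p. 428, GAPS G-B9-09) needs, inside its (h1) slot (Prop. 5.4), the
(R-M) letter of §5.3: «`Q_k(U) = M_k + E_k`, `Σ_{c∈Λ_k}|(E_kA)(c)|² ≤ c_E²ε_F²‖A‖²_{L²(Ω_k)}`, `c_E = c_E(d,L)` uniform in `k` … Evidence: B7 (125),
(134), and (139)–(143): the composed operator differs from its «main part» by `|(·)A|(c) ≤ 2C′₁α₀(Q″_k|A|)(c)` with `Q″_k` the `L¹` block average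
(141), uniformly in `k` …; Jensen on `Q″_k` gives the `ℓ²`-form above.»  The IDENTIFICATION of the main part is the note's one delicate reading
(census §8.1) and stays a reading.  The PASSAGE from the printed-type sup∕`L¹`-average domination to the `ℓ²` letter is elementary and was not in
the tree: `…AveragedCurlFormSplit` (leaf-02 g132) DISPLAYS `hE : ∀ A, Σ_c sz(E A) c² ≤ c_E·NΩ A` and records in its NOT-HERE «(R-M)'s `c_E` … at
one step the tree's `B7Prop3GeneralLinearBound.norm_linQcov_sub_main_le` is the sup-norm form — the `k`-uniform `ℓ²` form is NOT in the tree».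
THIS FILE is that passage, for ANY pair of finite index sets (unit bonds `m`, fine bonds `n`) with a fine measure `w` (print: `w_b = η^d`, so
`Σ_b w_b A_b² = ‖A‖²_{L²(Ω_k)}`) and ANY assignment of double blocks `dbl : m → Finset n`: the constant is `ε²·D·μ` with `D` the block MASS
(`Σ_{b∈dbl c} w_b`, `= 2` for two unit blocks) and `μ` the MULTIPLICITY of a fine bond in the double blocks — it does NOT see the ratio `η = L^{−k}`
of the two spacings, which is the point of «uniformly in `k`».

WHAT IS PROVED ([folklore]; `K : m → n → ℝ` a non-negative kernel, `R : (n → ℝ) → (m → ℝ)` any map, `E : Matrix m n ℝ`):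
* §1 JENSEN FOR A ROW: **`sq_sum_mul_abs_le`** (`(Σ_b K b·|x b|)² ≤ (Σ_b K b)·(Σ_b K b·x b²)` — Mathlib's finset Cauchy–Schwarz with `r = K|x|`,
  `f = K`, `g = Kx²`), `sq_sum_mul_abs_le_of_mass` (`Σ_b K b ≤ D` consumed).
* §2 THE LETTER: **`sum_sq_le_of_average_dominated`** (`K ≥ 0`, `0 ≤ D`, rows `Σ_b K_{cb} ≤ D`, columns `Σ_c K_{cb} ≤ μ·w_b`,
  `|(R A) c| ≤ ε·Σ_b K_{cb}|A_b|` ⊢ `Σ_c ((R A) c)² ≤ ε²·D·μ·Σ_b w_b·A_b²` — square, Jensen per row, exchange the sums, column multiplicity);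
  **`sum_sq_mulVec_le_of_entry_dominated`** (a matrix `E` with `|E c b| ≤ ε·K_{cb}` — the B7 (147)-type kernel form — is so dominated).
* §3 THE BLOCK INSTANCE `K_{cb} := w_b·𝟙[b ∈ dbl c]` (written inline, no `def`): `blockKernel_nonneg ∕ _rowSum ∕ _colSum ∕ _average` (rows = block
  masses, columns = `w_b·#{c : b ∈ dbl c}`, the domination = `ε·Σ_{b∈dbl c} w_b|A_b|`), **`sum_sq_le_of_block_dominated`** (`w ≥ 0`, masses `≤ D`,
  multiplicities `≤ μ`, block-`L¹` domination ⊢ `Σ_c ((R A) c)² ≤ ε²·D·μ·Σ_b w_b A_b²`).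
* §4 THE END IN THE CONSUMER's SHAPE: **`hE_of_block_dominated`** — for a matrix remainder with `|E c b| ≤ ε·w_b` on `dbl c` and `E c b = 0` off it:
  `∀ A, Σ_c sz (E *ᵥ A) c ^ 2 ≤ (ε²·D·μ) · NΩ A` with `sz := fun B c ↦ |B c|`, `NΩ := fun A ↦ Σ_b w_b·A_b²` — VERBATIM the `hE` hypothesis of
  `…AveragedCurlFormSplit.curlForm_letter_of_split_mulVec` (so its `q = 2q_M + 2ℓ²ab·c_E` reads `c_E := ε²Dμ` from three counted letters).
* §5 toy (kernel): one unit bond over two fine bonds of measure `½` (`D = μ = 1`), `R A = ε(A₀+A₁)∕2`: the letter is Jensen, attained at `A₀ = A₁`.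

NOT HERE (honest): the domination letter itself — WHICH operator is the main part `M_k` of `Q_k(U)` and that the remainder is dominated by
`2C′₁α₀·Q″_k|A|` uniformly in `k` (B7 (139)–(147) as printed + the reading (R-M), census §8.1 — the note's one delicate identification; at one step
the tree has `B7Prop3GeneralLinearBound.norm_linQcov_sub_main_le` in sup norm); the VALUES `D = 2`, `μ = μ(d, L)` for print's double blocks
`B^k(c₋) ∪ B^k(c₊)` and the normalisation `w_b = η^d` ((A3) ∕ (A1c), NC-NE7b-α UNRULED); `ε = 2C′₁α₀` vs the memo's `c_Eε_F` bookkeeping (which small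
parameter carries the letter is the reading's, not this file's); the junction with `…AveragedCurlFormSplit` BY IMPORT (staged, no olean — BY SHAPE
here).  BY-NAME EFFECT ON THE WALL: NONE (one displayed letter of the (h1) slot becomes three counted ones; the wall is (R2)).  NE7b NOT PRINTED ∕
NOT PROVED; spine PROVED 0∕9; rung (B)+1 on a FINITE torus — NOT infinite volume, NOT the mass gap, NOT Clay.  HONEST DEPENDENCY: continuum YM
on T⁴ ⇐ BetaPertH ∧ nine spine estimates (0∕9 proved); BetaPertH ⇐ (D1) ∧ (D4) ∧ CAP+tail; G-an2-4 gates asym, D1 and NE2∕3∕4.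
-/

set_option autoImplicit false

open Finset Matrix

namespace Summit.QuantumFields.BalabanUV.T4Continuum.NE7b.AverageDominatedRemainderL2

variable {m n : Type*} [Fintype m] [Fintype n]

/-! ## §1 Jensen ∕ Cauchy–Schwarz for a non-negative kernel row: `(Σ_b K_{cb}|x_b|)² ≤ (Σ_b K_{cb})·(Σ_b K_{cb}x_b²)` -/

/-- **THE SQUARE OF A WEIGHTED `ℓ¹` AVERAGE IS DOMINATED BY THE WEIGHTED `ℓ²` AVERAGE TIMES THE MASS**: for non-negative weights `K b`,
`(Σ_b K b·|x b|)² ≤ (Σ_b K b)·(Σ_b K b·x b²)` (Cauchy–Schwarz with `r = K|x|`, `f = K`, `g = Kx²`; Jensen for the probability `K∕ΣK`). [folklore] -/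
theorem sq_sum_mul_abs_le (K x : n → ℝ) (hK : ∀ b, 0 ≤ K b) :
    (∑ b, K b * |x b|) ^ 2 ≤ (∑ b, K b) * ∑ b, K b * x b ^ 2 :=
  sum_sq_le_sum_mul_sum_of_sq_le_mul univ (fun b _ => hK b) (fun b _ => mul_nonneg (hK b) (sq_nonneg _))
    fun b _ => by rw [mul_pow, sq_abs]; exact le_of_eq (by ring)

/-- The same with the mass letter consumed: `Σ_b K b ≤ D` ⊢ `(Σ_b K b·|x b|)² ≤ D·Σ_b K b·x b²`. [folklore] -/
theorem sq_sum_mul_abs_le_of_mass (K x : n → ℝ) (hK : ∀ b, 0 ≤ K b) {D : ℝ} (hD : ∑ b, K b ≤ D) :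
    (∑ b, K b * |x b|) ^ 2 ≤ D * ∑ b, K b * x b ^ 2 :=
  (sq_sum_mul_abs_le K x hK).trans
    (mul_le_mul_of_nonneg_right hD (sum_nonneg fun b _ => mul_nonneg (hK b) (sq_nonneg _)))

/-! ## §2 The `ℓ²` letter of an average-dominated remainder -/

section Letter

variable {K : m → n → ℝ} {w : n → ℝ} {D μ : ℝ}

/-- **THE (R-M) `ℓ²` LETTER FROM AN AVERAGE DOMINATION.**  Unit-lattice index `m`, fine index `n` with a measure `w ≥ 0` (in print `w_b = η^d`,
so that `Σ_b w_b·A_b² = ‖A‖²_{L²(Ω_k)}`); a remainder map `R : (n → ℝ) → (m → ℝ)` DOMINATED BY AN AVERAGE, `|(R A) c| ≤ ε·Σ_b K_{cb}|A_b|` with a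
non-negative kernel `K` whose rows have mass `Σ_b K_{cb} ≤ D` (`D ≥ 0` — automatic when `m` is inhabited) and whose columns have `w`-weighted multiplicity `Σ_c K_{cb} ≤ μ·w_b`.  Then
`Σ_c ((R A) c)² ≤ ε²·D·μ·Σ_b w_b·A_b²` — the sup-type domination integrates to an `ℓ²(unit) ← L²(fine)` bound whose constant `ε²Dμ` does not
see the ratio of the two lattice spacings. [folklore] -/
theorem sum_sq_le_of_average_dominated (hK : ∀ c b, 0 ≤ K c b) (hD : 0 ≤ D) (hrow : ∀ c, ∑ b, K c b ≤ D)
    (hcol : ∀ b, ∑ c, K c b ≤ μ * w b) (R : (n → ℝ) → (m → ℝ)) {ε : ℝ} (hdom : ∀ A c, |R A c| ≤ ε * ∑ b, K c b * |A b|)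
    (A : n → ℝ) : ∑ c, R A c ^ 2 ≤ ε ^ 2 * D * μ * ∑ b, w b * A b ^ 2 := by
  -- each unit-lattice term: square the domination, then Jensen on the row
  have hterm : ∀ c, R A c ^ 2 ≤ ε ^ 2 * (D * ∑ b, K c b * A b ^ 2) := by
    intro c
    have h1 : R A c ^ 2 ≤ (ε * ∑ b, K c b * |A b|) ^ 2 := by
      rw [← sq_abs (R A c)]
      exact pow_le_pow_left₀ (abs_nonneg _) (hdom A c) 2
    have h2 := sq_sum_mul_abs_le_of_mass (K c) A (hK c) (hrow c)
    calc R A c ^ 2 ≤ (ε * ∑ b, K c b * |A b|) ^ 2 := h1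
      _ = ε ^ 2 * (∑ b, K c b * |A b|) ^ 2 := by ring
      _ ≤ ε ^ 2 * (D * ∑ b, K c b * A b ^ 2) := mul_le_mul_of_nonneg_left h2 (sq_nonneg ε)
  -- sum over the unit lattice and exchange the two sums: the column multiplicity appears
  have hswap : ∑ c, ∑ b, K c b * A b ^ 2 = ∑ b, (∑ c, K c b) * A b ^ 2 := by
    rw [sum_comm]
    exact sum_congr rfl fun b _ => by rw [sum_mul]
  have hcolsum : ∑ b, (∑ c, K c b) * A b ^ 2 ≤ ∑ b, μ * w b * A b ^ 2 :=
    sum_le_sum fun b _ => mul_le_mul_of_nonneg_right (hcol b) (sq_nonneg _)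
  calc ∑ c, R A c ^ 2 ≤ ∑ c, ε ^ 2 * (D * ∑ b, K c b * A b ^ 2) := sum_le_sum fun c _ => hterm c
    _ = ε ^ 2 * D * ∑ c, ∑ b, K c b * A b ^ 2 := by rw [mul_sum]; exact sum_congr rfl fun c _ => by ring
    _ = ε ^ 2 * D * ∑ b, (∑ c, K c b) * A b ^ 2 := by rw [hswap]
    _ ≤ ε ^ 2 * D * ∑ b, μ * w b * A b ^ 2 := mul_le_mul_of_nonneg_left hcolsum (by positivity)
    _ = ε ^ 2 * D * μ * ∑ b, w b * A b ^ 2 := by rw [mul_sum, mul_sum]; exact sum_congr rfl fun b _ => by ring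

/-- **THE SAME FOR A MATRIX REMAINDER WITH DOMINATED ENTRIES** (the B7 (147)-type kernel form): `|E c b| ≤ ε·K_{cb}` entrywise ⊢ the
domination `|(E A) c| ≤ ε·Σ_b K_{cb}|A_b|`, hence `Σ_c ((E *ᵥ A) c)² ≤ ε²·D·μ·Σ_b w_b·A_b²`. [folklore] -/
theorem sum_sq_mulVec_le_of_entry_dominated (hK : ∀ c b, 0 ≤ K c b) (hD : 0 ≤ D) (hrow : ∀ c, ∑ b, K c b ≤ D)
    (hcol : ∀ b, ∑ c, K c b ≤ μ * w b) (E : Matrix m n ℝ) {ε : ℝ} (hE : ∀ c b, |E c b| ≤ ε * K c b) (A : n → ℝ) :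
    ∑ c, (E *ᵥ A) c ^ 2 ≤ ε ^ 2 * D * μ * ∑ b, w b * A b ^ 2 := by
  refine sum_sq_le_of_average_dominated hK hD hrow hcol (fun A => E *ᵥ A) (fun A c => ?_) A
  calc |(E *ᵥ A) c| = |∑ b, E c b * A b| := rfl
    _ ≤ ∑ b, |E c b * A b| := abs_sum_le_sum_abs _ _
    _ = ∑ b, |E c b| * |A b| := sum_congr rfl fun b _ => abs_mul _ _
    _ ≤ ∑ b, ε * K c b * |A b| := sum_le_sum fun b _ => mul_le_mul_of_nonneg_right (hE c b) (abs_nonneg _)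
    _ = ε * ∑ b, K c b * |A b| := by rw [mul_sum]; exact sum_congr rfl fun b _ => by ring

end Letter

/-! ## §3 The instance: the kernel is the fine measure restricted to a double block -/

section Blocks

variable [DecidableEq n] (dbl : m → Finset n) (w : n → ℝ)

omit [Fintype m] [Fintype n] in
/-- The block kernel `K_{cb} := w_b·𝟙[b ∈ dbl(c)]` (the fine measure `η^d` of the bonds of the double block of the unit bond `c`), written as a
function — no `def`: it is the λ-term `fun c b => if b ∈ dbl c then w b else 0` in every statement below. Non-negative for `w ≥ 0`. [folklore] -/
theorem blockKernel_nonneg (hw : ∀ b, 0 ≤ w b) (c : m) (b : n) : 0 ≤ (if b ∈ dbl c then w b else 0) := by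
  split_ifs
  · exact hw b
  · exact le_rfl

omit [Fintype m] in
/-- Its ROW SUMS are the MASSES of the double blocks: `Σ_b K_{cb} = Σ_{b ∈ dbl c} w_b`. [folklore] -/
theorem blockKernel_rowSum (c : m) : ∑ b, (if b ∈ dbl c then w b else 0) = ∑ b ∈ dbl c, w b := by
  rw [sum_ite_mem, univ_inter]

omit [Fintype n] in
/-- Its COLUMN SUMS are `w_b` times the MULTIPLICITY of the fine bond `b` in the double blocks: `Σ_c K_{cb} = w_b·#{c : b ∈ dbl c}`. [folklore] -/
theorem blockKernel_colSum [DecidableEq m] (b : n) :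
    ∑ c, (if b ∈ dbl c then w b else 0) = w b * ((univ.filter fun c => b ∈ dbl c).card : ℝ) := by
  rw [← sum_filter, sum_const, nsmul_eq_mul, mul_comm]

omit [Fintype m] in
/-- The domination in block form: `Σ_b K_{cb}|A_b| = Σ_{b ∈ dbl c} w_b|A_b|` (the un-normalised `L¹(dbl c)` mass of `A`). [folklore] -/
theorem blockKernel_average (c : m) (A : n → ℝ) :
    ∑ b, (if b ∈ dbl c then w b else 0) * |A b| = ∑ b ∈ dbl c, w b * |A b| := by
  simp_rw [ite_mul, zero_mul]
  rw [sum_ite_mem, univ_inter]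

/-- **THE (R-M) `ℓ²` LETTER FROM A BLOCK-`L¹` DOMINATION** — the elementary half of `SectE-interface-proof.md` §5.3 («Jensen on `Q″_k` gives the
`ℓ²`-form»): fine measure `w ≥ 0`; double blocks `dbl c` of mass `Σ_{b ∈ dbl c} w_b ≤ D` and multiplicity `#{c : b ∈ dbl c} ≤ μ`; a remainder
`R` with `|(R A) c| ≤ ε·Σ_{b ∈ dbl c} w_b|A_b|` (the printed-type kernel estimate «`|(Q_k − main)A|(c) ≤ 2C′₁α₀(Q″_k|A|)(c)`» with `Q″_k` the `L¹`
block average, read BY SHAPE) ⊢ `Σ_c ((R A) c)² ≤ ε²·D·μ·Σ_b w_b A_b²`, i.e. `c_E² := ε²Dμ` in the (R-M) letter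
`Σ_c |(E_kA)(c)|² ≤ c_E²‖A‖²_{L²(Ω_k)}`. [folklore] -/
theorem sum_sq_le_of_block_dominated [DecidableEq m] (hw : ∀ b, 0 ≤ w b) {D : ℝ} (hD : 0 ≤ D) {μ : ℕ}
    (hmass : ∀ c, ∑ b ∈ dbl c, w b ≤ D) (hmult : ∀ b, (univ.filter fun c => b ∈ dbl c).card ≤ μ)
    (R : (n → ℝ) → (m → ℝ)) {ε : ℝ} (hdom : ∀ A c, |R A c| ≤ ε * ∑ b ∈ dbl c, w b * |A b|) (A : n → ℝ) :
    ∑ c, R A c ^ 2 ≤ ε ^ 2 * D * μ * ∑ b, w b * A b ^ 2 := by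
  have hcol : ∀ b, ∑ c, (if b ∈ dbl c then w b else 0) ≤ (μ : ℝ) * w b := fun b => by
    rw [blockKernel_colSum, mul_comm]
    have hμ : ((univ.filter fun c => b ∈ dbl c).card : ℝ) ≤ (μ : ℝ) := by exact_mod_cast hmult b
    exact mul_le_mul_of_nonneg_right hμ (hw b)
  exact sum_sq_le_of_average_dominated (K := fun c b => if b ∈ dbl c then w b else 0) (blockKernel_nonneg dbl w hw) hD
    (fun c => by rw [blockKernel_rowSum]; exact hmass c) hcol R (fun A c => by rw [blockKernel_average]; exact hdom A c) A

end Blocks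

/-! ## §4 The END in the consumer's letter shape (`…AveragedCurlFormSplit.curlForm_letter_of_split_mulVec`'s `hE`) -/

section End

variable [DecidableEq m] [DecidableEq n]

/-- **THE `hE` LETTER OF THE SPLIT, SUPPLIED**: with bond sizes `sz B c := |B c|` and the fine norm `NΩ A := Σ_b w_b·A_b²` (`= ‖A‖²_{L²(Ω_k)}` at
`w_b = η^d`), a matrix remainder `E` (`Q = M + E`) whose entries are dominated by the block measure, `|E c b| ≤ ε·w_b` on `dbl c` and `E c b = 0`
off it, gives `∀ A, Σ_c sz (E *ᵥ A) c ^ 2 ≤ c_E · NΩ A` with `c_E := ε²·D·μ` — verbatim the `hE` hypothesis of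
`…AveragedCurlFormSplit.curlForm_letter_of_split(_mulVec)` (leaf-02 g132), from three counted letters (`D` block mass, `μ` multiplicity, `ε` the
kernel size) instead of one displayed `c_E`. [folklore] -/
theorem hE_of_block_dominated (dbl : m → Finset n) (w : n → ℝ) (hw : ∀ b, 0 ≤ w b) {D : ℝ} (hD : 0 ≤ D) {μ : ℕ}
    (hmass : ∀ c, ∑ b ∈ dbl c, w b ≤ D) (hmult : ∀ b, (univ.filter fun c => b ∈ dbl c).card ≤ μ)
    (E : Matrix m n ℝ) {ε : ℝ} (hE : ∀ c b, b ∈ dbl c → |E c b| ≤ ε * w b) (hE0 : ∀ c b, b ∉ dbl c → E c b = 0) :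
    ∀ A : n → ℝ, ∑ c, (fun (B : m → ℝ) (c : m) => |B c|) (E *ᵥ A) c ^ 2
      ≤ (ε ^ 2 * D * μ) * (fun A : n → ℝ => ∑ b, w b * A b ^ 2) A := by
  intro A
  have hcol : ∀ b, ∑ c, (if b ∈ dbl c then w b else 0) ≤ (μ : ℝ) * w b := fun b => by
    rw [blockKernel_colSum, mul_comm]
    have hμ : ((univ.filter fun c => b ∈ dbl c).card : ℝ) ≤ (μ : ℝ) := by exact_mod_cast hmult b
    exact mul_le_mul_of_nonneg_right hμ (hw b)
  have hent : ∀ c b, |E c b| ≤ ε * (if b ∈ dbl c then w b else 0) := fun c b => by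
    by_cases hb : b ∈ dbl c
    · rw [if_pos hb]; exact hE c b hb
    · rw [if_neg hb, hE0 c b hb, abs_zero, mul_zero]
  have h := sum_sq_mulVec_le_of_entry_dominated (K := fun c b => if b ∈ dbl c then w b else 0) (μ := (μ : ℝ))
    (blockKernel_nonneg dbl w hw) hD (fun c => by rw [blockKernel_rowSum]; exact hmass c) hcol E hent A
  simpa only [sq_abs] using h

end End

/-! ## §5 Toys (kernel): the letters are inhabited and the constant is attained -/

/-- Toy: ONE unit bond whose double block is both fine bonds of `Fin 2`, each of measure `½` (`D = 1`, `μ = 1`); the remainder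
`R A := ε·(A₀ + A₁)∕2` is dominated with constant `|ε|` and §3 returns `(ε(A₀+A₁)∕2)² ≤ ε²·1·1·(A₀² + A₁²)∕2` — Jensen, attained at `A₀ = A₁`. -/
example (ε : ℝ) (hε : 0 ≤ ε) (A : Fin 2 → ℝ) :
    ∑ c : Fin 1, (fun (A : Fin 2 → ℝ) (_ : Fin 1) => ε * ((A 0 + A 1) / 2)) A c ^ 2
      ≤ ε ^ 2 * 1 * ((1 : ℕ) : ℝ) * ∑ b : Fin 2, (1 / 2 : ℝ) * A b ^ 2 := by
  refine sum_sq_le_of_block_dominated (fun _ : Fin 1 => (univ : Finset (Fin 2))) (fun _ => (1 / 2 : ℝ))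
    (fun _ => by norm_num) zero_le_one (μ := 1) (fun _ => by simp) (fun b => by simp)
    (fun (A : Fin 2 → ℝ) (_ : Fin 1) => ε * ((A 0 + A 1) / 2)) (fun A c => ?_) A
  rw [Fin.sum_univ_two, abs_mul, abs_of_nonneg hε]
  refine mul_le_mul_of_nonneg_left ?_ hε
  calc |(A 0 + A 1) / 2| = |A 0 + A 1| / 2 := by rw [abs_div, abs_two]
    _ ≤ (|A 0| + |A 1|) / 2 := by gcongr; exact abs_add_le _ _
    _ = 1 / 2 * |A 0| + 1 / 2 * |A 1| := by ring

end Summit.QuantumFields.BalabanUV.T4Continuum.NE7b.AverageDominatedRemainderL2
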